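import Mathlib
import Summits.KontsevichZagierPeriods.Zeta5Search.ClusterBoundSeries
import Summits.KontsevichZagierPeriods.Zeta5Search.PadicCoeffBound
import HarnessLib

/-!
# ζ(5) search — THEOREM A (cluster bound), THEOREM A′ (isolated poles) and the class `V`-bound are THEOREMS

Cell `pub-zeta5` (HONEST FRAMING: systematic search; no irrationality claim unless certified), typer seat
generation 8.  Discharges BY NAME three statements of gen-2's residue-class valuation theory
(`Zeta5Search/ClusterValuation.lean`, REPORT-gen2-g6 §2, g7 §2.3; found and proved on paper by the gen-2 seats,
machine-checked there on > 13,000 exact instances):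

* `clusterBound_holds : ClusterBound` — **Theorem A**: for `b` in the Brown–Zudilin polytope, a prime `p ≥ 3` with
  `p² > b₀ + 2`, a position `q ≤ b₀` and an order `o < 6`, the partial-fraction coefficient `c_{o,q}` of `R_b` has
  `v_p(c_{o,q}) ≥ (o+1) + E_{class(q)}` (`classExp`);
* `isolatedPoleIntegral_holds : IsolatedPoleIntegral` — **Theorem A′**: if `q` is the only pole of its residue class,
  every `c_{o,q}` is `p`-integral;
* `classVBound_holds : ClassVBound` — `v_p(V_x) ≥ E_x` for the class pieces of the constant term.

PROOF (power series over `ℚ`, files `ClusterBoundSeries` + `PadicCoeffBound`): `c_{o,q} = [X^{5−o}](X^{mult q}·G)`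
with `G = cen·∏_{s≠q}(X+(s−q))^{netExp s}` the regular part of `R_b` at the pole (`pf_eq_coeff_Gser`).  Each factor
has a `p`-adic SLOPE BOUND `‖[X^k]·‖_p ≤ p^{k−M_s}`: `M_s = netExp s` for `s ≡ q (mod p)` (there `‖s−q‖_p = p^{−1}`
EXACTLY because `0 < |s−q| ≤ b₀ < p²`; negative powers through the inverse recursion), `M_s = 0` for the other
positions (unit constant terms), and `[p ∣ b₀−2q]` for the centre factor `2X + (b₀−2q)` of odd `b₀`; offsets add up to
`classExp q − netExp q` (`gser_coeffBound`), whence `v_p(c_{o,q}) ≥ classExp q − netExp q − (5−o−mult q) = o+1+E`.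
For A′ the same factors are `p`-INTEGRAL (slope `0`) as soon as the other class members are non-poles; `ClassVBound`
follows from A and `‖H_q^{(σ)}‖_p ≤ p^{σ}` (`q < p²`).  Identities of rational numbers; nothing about irrationality.
-/

noncomputable section

open Finset PowerSeries

namespace Summit.KontsevichZagierPeriods.Zeta5Search.ClusterValuation

open Summit.KontsevichZagierPeriods.Zeta5Search.DualSeries (InBox)
open Summit.KontsevichZagierPeriods.Zeta5Search.WedgeDictionary (IsPFData pfData isPFData_pfData exists_isPFData)
open Summit.KontsevichZagierPeriods.Zeta5Search.CasoratianValuation (InPolytope)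
open Summit.KontsevichZagierPeriods.Zeta5Search.PadicSeries
open Literature.NumberTheory.Transcendental.BallRivoal (harm)

variable {p : ℕ} [hp : Fact p.Prime]

/-! ### The exact norm of `s − q` -/

/-- For `s ≠ q` in `[0,n]`, `n < p²`: `‖s − q‖_p = p^{−[p ∣ s−q]}` (the valuation is `0` or EXACTLY `1`). -/
theorem padicNorm_sub_eq {n s q : ℕ} (hs : s ≤ n) (hq : q ≤ n) (hsq : s ≠ q) (hn : n < p ^ 2) :
    padicNorm p ((s : ℚ) - q) = (p : ℚ) ^ (-(if (p : ℤ) ∣ (s : ℤ) - q then (1 : ℤ) else 0)) := by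
  have hz : ((s : ℚ) - q) = (((s : ℤ) - q : ℤ) : ℚ) := by push_cast; ring
  rw [hz]
  have hne0 : ((s : ℤ) - q) ≠ 0 := by omega
  split_ifs with hdvd
  · have hle : padicNorm p ((((s : ℤ) - q : ℤ)) : ℚ) ≤ (p : ℚ) ^ (-(1 : ℕ) : ℤ) :=
      padicNorm.dvd_iff_norm_le.1 (by simpa using hdvd)
    have hnot : ¬ ((p ^ 2 : ℕ) : ℤ) ∣ (s : ℤ) - q := by
      obtain ⟨P, hP⟩ : ∃ P : ℕ, P = p ^ 2 := ⟨_, rfl⟩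
      rw [← hP]
      rw [← hP] at hn
      intro h
      obtain ⟨m, hm⟩ := h
      have hP0 : (0 : ℤ) ≤ (P : ℤ) := by positivity
      rcases lt_trichotomy m 0 with hm0 | hm0 | hm0
      · have : (P : ℤ) * m ≤ (P : ℤ) * (-1) := mul_le_mul_of_nonneg_left (by omega) hP0
        omega
      · subst hm0; omega
      · have : (P : ℤ) * 1 ≤ (P : ℤ) * m := mul_le_mul_of_nonneg_left (by omega) hP0
        omega
    rw [padicNorm.dvd_iff_norm_le, not_le] at hnot
    rw [padicNorm.eq_zpow_of_nonzero (by exact_mod_cast hne0)] at hle hnot ⊢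
    rw [zpow_lt_zpow_iff_right₀ one_lt_p] at hnot
    rw [zpow_le_zpow_iff_right₀ one_lt_p] at hle
    congr 1
    push_cast at hle hnot ⊢
    omega
  · rw [(padicNorm.int_eq_one_iff _).2 hdvd]; simp

/-! ### Slope-`1` bounds for the factors of `Gser` -/

/-- The linear factor of the position `s`: offset `[p ∣ s−q]`. -/
theorem linS_bound {n s q : ℕ} (hs : s ≤ n) (hq : q ≤ n) (hsq : s ≠ q) (hn : n < p ^ 2) :
    CoeffBound p 1 (if (p : ℤ) ∣ (s : ℤ) - q then (1 : ℤ) else 0) (linS ((s : ℚ) - q)) :=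
  coeffBound_X_add_C (by split_ifs <;> omega) (padicNorm_sub_eq hs hq hsq hn).le

/-- Constant coefficient of `linS δ`. -/
theorem coeff_zero_linS (δ : ℚ) : coeff 0 (linS δ) = δ := by
  simp [linS, coeff_zero_eq_constantCoeff_apply]

/-- The factor of the position `s ≠ q` in `Gser`, `(X+(s−q))^{mult s}·((X+(s−q))^6)⁻¹`, has slope-`1` offset
`netExp s` if `s ≡ q (mod p)` and `0` otherwise. -/
theorem factor_bound (b : ℕ → ℤ) {s q : ℕ} (hs : s ≤ (b 0).toNat) (hq : q ≤ (b 0).toNat) (hsq : s ≠ q)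
    (hn : (b 0).toNat < p ^ 2) :
    CoeffBound p 1 (if (p : ℤ) ∣ (s : ℤ) - q then netExp b s else 0)
      (linS ((s : ℚ) - q) ^ mult b s * (linS ((s : ℚ) - q) ^ 6)⁻¹) := by
  set χ : ℤ := if (p : ℤ) ∣ (s : ℤ) - q then (1 : ℤ) else 0 with hχ
  have hlin : CoeffBound p 1 χ (linS ((s : ℚ) - q)) := linS_bound hs hq hsq hn
  have hpow := hlin.pow (mult b s)
  have h6 := hlin.pow 6
  have h0 : padicNorm p (coeff 0 (linS ((s : ℚ) - q) ^ 6)) = (p : ℚ) ^ (-((6 : ℕ) * χ)) :=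
    padicNorm_coeff_zero_pow (by rw [coeff_zero_linS]; exact padicNorm_sub_eq hs hq hsq hn) 6
  have hδ : ((s : ℚ) - q) ≠ 0 := sub_ne_zero.2 (by exact_mod_cast hsq)
  have hinv := h6.of_mul_eq_one h0 (PowerSeries.mul_inv_cancel _
    (by rw [constantCoeff_linS_pow]; exact pow_ne_zero _ hδ))
  have h := hpow.mul hinv
  have hm := mult_eq_netExp b s
  have e : ((mult b s : ℕ) : ℤ) * χ + -((6 : ℕ) * χ) = if (p : ℤ) ∣ (s : ℤ) - q then netExp b s else 0 := by
    rw [hχ]; split_ifs <;> push_cast <;> linarith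
  rw [e] at h
  exact h

/-- The centre factor: offset `0` for even `b₀`, `[p ∣ b₀ − 2q]` for odd `b₀` (at an odd prime). -/
theorem cen_bound (b : ℕ → ℤ) (q : ℕ) (hp2 : p ≠ 2) :
    CoeffBound p 1 (if (2 : ℤ) ∣ b 0 then 0 else if (p : ℤ) ∣ ((b 0).toNat : ℤ) - 2 * q then 1 else 0)
      (cenP b q : PowerSeries ℚ) := by
  unfold cenP
  split_ifs with hev hdvd
  · rw [Polynomial.coe_C]
    exact coeffBound_C (by simpa using padicNorm.of_nat (p := p) 2)
  · rw [Polynomial.coe_add, Polynomial.coe_mul, Polynomial.coe_C, Polynomial.coe_X, Polynomial.coe_C]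
    refine coeffBound_two_X_add_C le_rfl hp2 ?_
    have hz : ((((b 0).toNat : ℕ) : ℚ) - 2 * q) = ((((b 0).toNat : ℤ) - 2 * q : ℤ) : ℚ) := by push_cast; ring
    rw [hz]
    exact padicNorm.dvd_iff_norm_le.1 (by simpa using hdvd)
  · rw [Polynomial.coe_add, Polynomial.coe_mul, Polynomial.coe_C, Polynomial.coe_X, Polynomial.coe_C]
    refine coeffBound_two_X_add_C (by norm_num) hp2 ?_
    have hz : ((((b 0).toNat : ℕ) : ℚ) - 2 * q) = ((((b 0).toNat : ℤ) - 2 * q : ℤ) : ℚ) := by push_cast; ring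
    rw [hz, neg_zero, zpow_zero]
    exact padicNorm.of_int _

/-! ### The offset bookkeeping: `Σ_s M_s + M_cen = classExp q − netExp q` -/

omit hp in
/-- The positions `s ≠ q` of `[0,b₀]` congruent to `q` are the class of `q` minus `q`. -/
theorem filter_dvd_eq_classSet_erase (b : ℕ → ℤ) (q : ℕ) :
    ((range ((b 0).toNat + 1)).erase q).filter (fun s : ℕ => (p : ℤ) ∣ (s : ℤ) - q) = (classSet b p q).erase q := by
  ext s
  simp only [classSet, mem_filter, mem_erase, mem_range]
  have : (p : ℤ) ∣ (s : ℤ) - q ↔ s % p = q % p := by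
    rw [dvd_sub_comm]
    exact (Nat.modEq_iff_dvd).symm
  rw [this]
  tauto

omit hp in
/-- **The total offset is `classExp q − netExp q`.** -/
theorem offset_eq (b : ℕ → ℤ) (h0 : 0 ≤ b 0) {q : ℕ} (hq : q ≤ (b 0).toNat) :
    (if (2 : ℤ) ∣ b 0 then 0 else if (p : ℤ) ∣ ((b 0).toNat : ℤ) - 2 * q then 1 else 0) +
        ∑ s ∈ (range ((b 0).toNat + 1)).erase q, (if (p : ℤ) ∣ (s : ℤ) - q then netExp b s else 0) =
      classExp b p q - netExp b q := by
  have hb0 : b 0 = ((b 0).toNat : ℤ) := (Int.toNat_of_nonneg h0).symm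
  rw [← sum_filter, filter_dvd_eq_classSet_erase]
  have hqmem : q ∈ classSet b p q := mem_filter.2 ⟨mem_range.2 (by omega), rfl⟩
  have hsplit := add_sum_erase (classSet b p q) (fun s => netExp b s) hqmem
  have hcen : (if (2 : ℤ) ∣ b 0 then (0 : ℤ) else if (p : ℤ) ∣ ((b 0).toNat : ℤ) - 2 * q then 1 else 0) =
      (if ¬ (2 : ℤ) ∣ b 0 ∧ CentreIn b p q then 1 else 0) := by
    by_cases hev : (2 : ℤ) ∣ b 0
    · simp [hev]
    · have : CentreIn b p q ↔ (p : ℤ) ∣ ((b 0).toNat : ℤ) - 2 * q := by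
        unfold CentreIn; rw [← hb0, dvd_sub_comm]
      simp [hev, this]
  rw [hcen, classExp, ← hsplit]
  ring

/-- **Slope-`1` bound for the regular part**: `‖[X^k] Gser b q‖_p ≤ p^{k − (classExp q − netExp q)}`. -/
theorem gser_coeffBound (b : ℕ → ℤ) (h0 : 0 ≤ b 0) {q : ℕ} (hq : q ≤ (b 0).toNat) (hn : (b 0).toNat < p ^ 2)
    (hp2 : p ≠ 2) : CoeffBound p 1 (classExp b p q - netExp b q) (Gser b q) := by
  rw [← offset_eq b h0 hq, Gser]
  refine (cen_bound b q hp2).mul (CoeffBound.prod _ _ _ fun s hs => ?_)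
  have hs' := mem_erase.1 hs
  exact factor_bound b (Nat.lt_succ_iff.1 (mem_range.1 hs'.2)) hq hs'.1 hn

/-! ### Slope-`0` (integrality) when the other class members are non-poles -/

/-- If every position `s ≠ q` congruent to `q` is a non-pole, `Gser b q` has `p`-integral coefficients. -/
theorem gser_integral (b : ℕ → ℤ) {q : ℕ} (hq : q ≤ (b 0).toNat) (hn : (b 0).toNat < p ^ 2) (hp2 : p ≠ 2)
    (hreg : ∀ s, s ≤ (b 0).toNat → s ≠ q → (p : ℤ) ∣ (s : ℤ) - q → 0 ≤ netExp b s) :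
    CoeffBound p 0 0 (Gser b q) := by
  have hcen : CoeffBound p 0 0 (cenP b q : PowerSeries ℚ) := by
    unfold cenP
    split_ifs with hev
    · rw [Polynomial.coe_C]
      exact coeffBound_C (by simpa using padicNorm.of_nat (p := p) 2)
    · rw [Polynomial.coe_add, Polynomial.coe_mul, Polynomial.coe_C, Polynomial.coe_X, Polynomial.coe_C]
      refine coeffBound_two_X_add_C le_rfl hp2 ?_
      have hz : ((((b 0).toNat : ℕ) : ℚ) - 2 * q) = ((((b 0).toNat : ℤ) - 2 * q : ℤ) : ℚ) := by push_cast; ring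
      rw [hz, neg_zero, zpow_zero]
      exact padicNorm.of_int _
  have hprod : CoeffBound p 0 (∑ _s ∈ (range ((b 0).toNat + 1)).erase q, (0 : ℤ))
      (∏ s ∈ (range ((b 0).toNat + 1)).erase q, (linS ((s : ℚ) - q) ^ mult b s * (linS ((s : ℚ) - q) ^ 6)⁻¹)) := by
    refine CoeffBound.prod _ _ _ fun s hs => ?_
    have hs' := mem_erase.1 hs
    have hsn : s ≤ (b 0).toNat := Nat.lt_succ_iff.1 (mem_range.1 hs'.2)
    have hδ : ((s : ℚ) - q) ≠ 0 := sub_ne_zero.2 (by exact_mod_cast hs'.1)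
    have hint : padicNorm p ((s : ℚ) - q) ≤ (p : ℚ) ^ (-(0 : ℤ)) := by
      have hz : ((s : ℚ) - q) = (((s : ℤ) - q : ℤ) : ℚ) := by push_cast; ring
      rw [hz, neg_zero, zpow_zero]; exact padicNorm.of_int _
    have hlin : CoeffBound p 0 0 (linS ((s : ℚ) - q)) := coeffBound_X_add_C le_rfl hint
    by_cases hdvd : (p : ℤ) ∣ (s : ℤ) - q
    · -- a non-pole of the class: a genuine polynomial factor
      have hreg' := hreg s hsn hs'.1 hdvd
      have hm := mult_eq_netExp b s
      have h6 : 6 ≤ mult b s := by omega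
      rw [linS_pow_mul_inv hδ h6]
      simpa using hlin.pow (mult b s - 6)
    · -- a far position: unit constant term, the inverse is integral too
      have hexact : padicNorm p ((s : ℚ) - q) = (p : ℚ) ^ (-(0 : ℤ)) := by
        have := padicNorm_sub_eq (p := p) hsn hq hs'.1 hn
        simpa [hdvd] using this
      have h0 : padicNorm p (coeff 0 (linS ((s : ℚ) - q) ^ 6)) = (p : ℚ) ^ (-((6 : ℕ) * (0 : ℤ))) :=
        padicNorm_coeff_zero_pow (by rw [coeff_zero_linS]; exact hexact) 6
      have hinv := (hlin.pow 6).of_mul_eq_one h0 (PowerSeries.mul_inv_cancel _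
        (by rw [constantCoeff_linS_pow]; exact pow_ne_zero _ hδ))
      simpa using (hlin.pow (mult b s)).mul hinv
  have h := hcen.mul hprod
  unfold Gser
  simpa using h

/-! ### Common bookkeeping for the three theorems -/

omit hp in
/-- Polytope data used below: box, `2b_j ≤ b₀+1`, the partial-fraction data, and `b₀ < p²`. -/
theorem thmA_data (b : ℕ → ℤ) (hb : InPolytope b) (hwin : (b 0 + 2 : ℤ) < (p : ℤ) ^ 2) :
    InBox b ∧ (∀ j ∈ range 7, 2 * b (j + 1) ≤ b 0 + 1) ∧ IsPFData b (pfData b) ∧ (b 0).toNat < p ^ 2 := by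
  obtain ⟨hbox, h2, h3⟩ := hb
  have hhalf : ∀ j ∈ range 7, 2 * b (j + 1) ≤ b 0 + 1 := fun j hj => by have := h2 j hj; omega
  obtain ⟨c, hc⟩ := exists_isPFData b hbox (by omega)
  refine ⟨hbox, hhalf, isPFData_pfData hc, ?_⟩
  have hb0 : b 0 = ((b 0).toNat : ℤ) := (Int.toNat_of_nonneg hbox.1).symm
  have : (((b 0).toNat : ℕ) : ℤ) < ((p ^ 2 : ℕ) : ℤ) := by push_cast; linarith
  exact_mod_cast this

/-! ### Theorem A -/

/-- **THEOREM A (cluster bound) is a theorem**: `v_p(c_{o,q}) ≥ (o+1) + E_{class(q)}` for `b` in the polytope,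
`p ≥ 3` prime with `p² > b₀+2`, `q ≤ b₀`, `o < 6`, `c_{o,q} ≠ 0`. -/
theorem clusterBound_holds : ClusterBound := by
  intro b p q o hb hprime hp3 hwin hq ho hne
  haveI : Fact p.Prime := ⟨hprime⟩
  obtain ⟨hbox, hhalf, hpf, hn⟩ := thmA_data b hb hwin
  have hp2 : p ≠ 2 := by omega
  have hid := pf_eq_coeff_Gser b hbox hhalf hpf hq ho
  rw [coeff_X_pow_mul'] at hid
  split_ifs at hid with hle
  · have hG := gser_coeffBound b hbox.1 hq hn hp2
    have hne' : coeff (5 - o - mult b q) (Gser b q) ≠ 0 := fun h => hne (hid.trans h)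
    have hv := hG.le_padicValRat hne'
    rw [← hid] at hv
    have hm := mult_eq_netExp b q
    have e : ((5 - o - mult b q : ℕ) : ℤ) = 5 - (o : ℤ) - (mult b q : ℤ) := by omega
    rw [e] at hv
    linarith
  · exact absurd hid hne

/-! ### Theorem A′ -/

/-- **THEOREM A′ (an isolated pole is `p`-integral) is a theorem**: if `q` is the only pole of its residue class
(`classPoleCount b p q = 1`), every `c_{o,q}` is `p`-integral. -/
theorem isolatedPoleIntegral_holds : IsolatedPoleIntegral := by
  intro b p q o hb hprime hp3 hwin hq ho hne hiso
  haveI : Fact p.Prime := ⟨hprime⟩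
  obtain ⟨hbox, hhalf, hpf, hn⟩ := thmA_data b hb hwin
  have hp2 : p ≠ 2 := by omega
  have hid := pf_eq_coeff_Gser b hbox hhalf hpf hq ho
  rw [coeff_X_pow_mul'] at hid
  split_ifs at hid with hle
  · -- `q` is a pole (`mult q ≤ 5`), hence THE pole of its class: the other class members are non-poles
    have hm := mult_eq_netExp b q
    have hqpole : netExp b q < 0 := by omega
    have hreg : ∀ s, s ≤ (b 0).toNat → s ≠ q → (p : ℤ) ∣ (s : ℤ) - q → 0 ≤ netExp b s := by
      intro s hs hsq hdvd
      by_contra hneg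
      push Not at hneg
      have hsub : ({q, s} : Finset ℕ) ⊆ (classSet b p q).filter fun t => netExp b t < 0 := by
        intro t ht
        rw [mem_insert, mem_singleton] at ht
        rw [mem_filter]
        have hsq' : s ∈ (classSet b p q).erase q := by
          rw [← filter_dvd_eq_classSet_erase]
          exact mem_filter.2 ⟨mem_erase.2 ⟨hsq, mem_range.2 (by omega)⟩, hdvd⟩
        rcases ht with rfl | rfl
        · exact ⟨mem_filter.2 ⟨mem_range.2 (by omega), rfl⟩, hqpole⟩
        · exact ⟨(mem_erase.1 hsq').2, hneg⟩
      have hcard := card_le_card hsub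
      rw [card_pair (Ne.symm hsq)] at hcard
      unfold classPoleCount at hiso
      omega
    have hG := gser_integral b hq hn hp2 hreg
    have hne' : coeff (5 - o - mult b q) (Gser b q) ≠ 0 := fun h => hne (hid.trans h)
    have hv := hG.le_padicValRat hne'
    rw [← hid] at hv
    simpa using hv
  · exact absurd hid hne

/-! ### The class `V`-bound -/

/-- `‖1/k^i‖_p ≤ p^i` for `1 ≤ k < p²` (the valuation of `k` is at most `1`). -/
theorem padicNorm_inv_pow_le {k : ℕ} (hk : 1 ≤ k) (hkp : k < p ^ 2) (i : ℕ) :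
    padicNorm p (1 / ((k : ℚ)) ^ i) ≤ (p : ℚ) ^ (i : ℤ) := by
  have hk0 : (k : ℚ) ≠ 0 := by exact_mod_cast (show k ≠ 0 by omega)
  have hv : padicValNat p k ≤ 1 := by
    by_contra h
    push Not at h
    have hdvd : p ^ 2 ∣ k := (pow_dvd_pow p h).trans pow_padicValNat_dvd
    exact absurd (Nat.le_of_dvd (by omega) hdvd) (by omega)
  rw [padicNorm.eq_zpow_of_nonzero (by positivity), one_div, padicValRat.inv, padicValRat.pow,
    padicValRat.of_nat, neg_neg]
  refine zpow_le_zpow_right₀ one_le_p ?_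
  have : (i : ℤ) * (padicValNat p k : ℤ) ≤ i * 1 := by
    exact mul_le_mul_of_nonneg_left (by exact_mod_cast hv) (by positivity)
  linarith

/-- `‖H_q^{(i)}‖_p ≤ p^i` for `q < p²` (`H_q^{(i)} = Σ_{k ≤ q} k^{−i}`). -/
theorem padicNorm_harm_le {q : ℕ} (hq : q < p ^ 2) (i : ℕ) : padicNorm p (harm i q) ≤ (p : ℚ) ^ (i : ℤ) := by
  unfold harm
  refine padicNorm.sum_le' (fun m hm => ?_) (zpow_p_nonneg _)
  have hm' := mem_range.1 hm
  have := padicNorm_inv_pow_le (p := p) (k := m + 1) (by omega) (by omega) i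
  simpa using this

omit hp in
/-- A class member determines the class. -/
theorem classSet_eq_of_mem {b : ℕ → ℤ} {x q : ℕ} (h : q ∈ classSet b p x) : classSet b p q = classSet b p x := by
  have hq : q % p = x % p := (mem_filter.1 h).2
  unfold classSet
  rw [hq]

omit hp in
/-- … and whether the centre lies in it. -/
theorem centreIn_iff_of_mem {b : ℕ → ℤ} {x q : ℕ} (h : q ∈ classSet b p x) : CentreIn b p q ↔ CentreIn b p x := by
  have hq : q % p = x % p := (mem_filter.1 h).2
  have hdvd : (p : ℤ) ∣ 2 * ((q : ℤ) - x) := Dvd.dvd.mul_left (by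
    rw [dvd_sub_comm]; exact Nat.modEq_iff_dvd.1 hq) 2
  unfold CentreIn
  rw [show (2 * (q : ℤ) - b 0) = 2 * ((q : ℤ) - x) + (2 * x - b 0) by ring]
  exact dvd_add_right hdvd

omit hp in
/-- … hence the class exponent. -/
theorem classExp_eq_of_mem {b : ℕ → ℤ} {x q : ℕ} (h : q ∈ classSet b p x) : classExp b p q = classExp b p x := by
  unfold classExp
  rw [classSet_eq_of_mem h]
  by_cases hc : CentreIn b p x
  · simp [hc, (centreIn_iff_of_mem h).2 hc]
  · have : ¬ CentreIn b p q := fun h' => hc ((centreIn_iff_of_mem h).1 h')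
    simp [hc, this]

/-- **The class `V`-bound is a theorem**: `v_p(V_x) ≥ E_x` (window `p² > b₀+2`, `p ≥ 5`). -/
theorem classVBound_holds : ClassVBound := by
  intro b p x hb hprime hp5 hwin _hx _hpole hne
  haveI : Fact p.Prime := ⟨hprime⟩
  obtain ⟨hbox, -, -, hn⟩ := thmA_data b hb hwin
  -- every term `c_{o,q} H_q^{(o+1)}` has norm ≤ p^{-E_x}
  have hterm : ∀ q ∈ classSet b p x, ∀ o ∈ range 6,
      padicNorm p (pfData b o q * harm (o + 1) q) ≤ (p : ℚ) ^ (-classExp b p x) := by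
    intro q hq o ho
    have hqn : q ≤ (b 0).toNat := Nat.lt_succ_iff.1 (mem_range.1 (mem_filter.1 hq).1)
    have ho' := mem_range.1 ho
    rw [padicNorm.mul]
    by_cases hc : pfData b o q = 0
    · rw [hc, padicNorm.zero, zero_mul]; exact zpow_p_nonneg _
    · have hA := clusterBound_holds b p q o hb hprime (by omega) hwin hqn ho' hc
      rw [classExp_eq_of_mem hq] at hA
      have hcn : padicNorm p (pfData b o q) ≤ (p : ℚ) ^ (-((o : ℤ) + 1 + classExp b p x)) := by
        rw [padicNorm.eq_zpow_of_nonzero hc]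
        exact zpow_le_zpow_right₀ one_le_p (by linarith)
      have hH := padicNorm_harm_le (p := p) (lt_of_le_of_lt hqn hn) (o + 1)
      calc padicNorm p (pfData b o q) * padicNorm p (harm (o + 1) q)
          ≤ (p : ℚ) ^ (-((o : ℤ) + 1 + classExp b p x)) * (p : ℚ) ^ ((o + 1 : ℕ) : ℤ) :=
            mul_le_mul hcn hH (padicNorm.nonneg _) (zpow_p_nonneg _)
        _ = (p : ℚ) ^ (-classExp b p x) := by
            rw [← zpow_add₀ (Nat.cast_ne_zero.2 hprime.ne_zero)]; congr 1; push_cast; ring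
  have hV : padicNorm p (classV b p x) ≤ (p : ℚ) ^ (-classExp b p x) := by
    unfold classV
    exact padicNorm.sum_le' (fun q hq => padicNorm.sum_le' (fun o ho => hterm q hq o ho) (zpow_p_nonneg _))
      (zpow_p_nonneg _)
  rw [padicNorm.eq_zpow_of_nonzero hne, zpow_le_zpow_iff_right₀ one_lt_p] at hV
  linarith

end Summit.KontsevichZagierPeriods.Zeta5Search.ClusterValuation

end
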